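import Mathlib

/-!
# Formal Barnes functionals I — the polynomial layer (cell `pub-zeta5`, fam-tele gen 4)

HONEST FRAMING: systematic search; no irrationality claim unless certified.

OUR infrastructure (Summit side; no named facts, no analysis).  The kernel blueprint
`families/tele/RECURRENCE.md §13` replaces Zudilin's Barnes integrals `(1/2πi)∫ (π/sin πt)² R(t) dt` by FORMAL
ℚ-linear functionals on partial-fraction data.  This file is the polynomial part: for a node `s` (the contour
`Re t = s − 1/2`) and `Q ∈ ℚ[X]`,
  `lamPoly d s Q = Σ_{ℓ ≤ d} (−1)^ℓ Δ^ℓ[Q](s)/(ℓ+1)`   (`Δ` = Mathlib's forward difference `fwdDiff 1`),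
which is independent of `d ≥ deg Q` (`lamPoly_eq_of_le`), satisfies the SHIFT law
`lamPoly d s (Q ∘ (X+1)) = lamPoly d (s+1) Q` (`lamPoly_shift`) and the CROSSING law
`lamPoly d (s+1) Q − lamPoly d s Q = Q′(s)` (`lamPoly_crossing`; the formal residue of `(π/sin πt)² Q` at the
integer `s`) — the latter is the operator identity `log(1+Δ) = d/dt` on `ℚ[X]`, proved here from the Gregory–Newton
expansion `Q(X+s) = Σ_ℓ Δ^ℓ[Q](s)·binom(X,ℓ)` (`newton_expansion`) by differentiating at `0`
(`derivative_eval_eq_sum_fwdDiff`).  With `s = 1 − a₂*` and `Q = polyP a b`, `lamPoly` is literally the `A_ℓ`-sum of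
`Zudilin2014.FirstTale.formP` (`coefA`), which is the point of the construction.
-/

noncomputable section

open Polynomial Finset fwdDiff

namespace Summit.KontsevichZagierPeriods.Zeta5Search.FormalBarnes

/-! ### Newton polynomials at the node `0` -/

/-- `newton ℓ = X(X−1)⋯(X−ℓ+1)/ℓ!` (so `newton ℓ (m) = binom(m, ℓ)` at naturals). -/
def newton (ℓ : ℕ) : ℚ[X] := C ((ℓ.factorial : ℚ)⁻¹) * descPochhammer ℚ ℓ

/-- `ℓ! ≠ 0` in `ℚ`. (docstring added by the filing lane, lint only) -/
theorem factorial_ne_zero' (ℓ : ℕ) : (ℓ.factorial : ℚ) ≠ 0 := by exact_mod_cast (Nat.factorial_pos ℓ).ne'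

/-- `newton ℓ` takes the value `binom(m, ℓ)` at a natural number `m`. (docstring added by the filing lane, lint only) -/
theorem eval_newton_nat (ℓ m : ℕ) : (newton ℓ).eval (m : ℚ) = (m.choose ℓ : ℚ) := by
  unfold newton
  rw [eval_mul, eval_C, descPochhammer_eval_eq_descFactorial, Nat.descFactorial_eq_factorial_mul_choose]
  have hf := factorial_ne_zero' ℓ
  push_cast
  field_simp

/-- `newton ℓ` has degree `ℓ`. (docstring added by the filing lane, lint only) -/
theorem natDegree_newton (ℓ : ℕ) : (newton ℓ).natDegree = ℓ := by
  unfold newton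
  rw [natDegree_C_mul (inv_ne_zero (factorial_ne_zero' ℓ)), descPochhammer_natDegree]

/-- `(descPochhammer ℚ ℓ)(−1) = (−1)^ℓ ℓ!`. -/
theorem descPochhammer_eval_neg_one (ℓ : ℕ) : (descPochhammer ℚ ℓ).eval (-1) = (-1) ^ ℓ * (ℓ.factorial : ℚ) := by
  rw [descPochhammer_eval_eq_prod_range]
  induction ℓ with
  | zero => simp
  | succ n ih =>
    rw [prod_range_succ, ih, Nat.factorial_succ]
    push_cast
    ring

/-- `newton (ℓ+1)′(0) = (−1)^ℓ/(ℓ+1)`. -/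
theorem derivative_newton_succ_eval_zero (ℓ : ℕ) :
    (derivative (newton (ℓ + 1))).eval 0 = (-1) ^ ℓ / ((ℓ : ℚ) + 1) := by
  unfold newton
  rw [derivative_C_mul, descPochhammer_succ_left, derivative_mul, eval_mul, eval_C, eval_add, eval_mul, eval_mul,
    derivative_X, eval_one, one_mul, eval_X, zero_mul, add_zero, eval_comp, eval_sub, eval_X, eval_one, zero_sub,
    descPochhammer_eval_neg_one, Nat.factorial_succ]
  have hf := factorial_ne_zero' ℓ
  push_cast
  field_simp

/-- The derivative of `newton 0 = 1` vanishes. (docstring added by the filing lane, lint only) -/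
theorem derivative_newton_zero : derivative (newton 0) = 0 := by
  simp [newton]

/-! ### Gregory–Newton expansion in `ℚ[X]` -/

/-- **Gregory–Newton**: `Q(X + s) = Σ_{ℓ ≤ d} Δ^ℓ[Q](s) · newton ℓ` whenever `deg Q ≤ d`. -/
theorem newton_expansion (Q : ℚ[X]) (s : ℚ) {d : ℕ} (hd : Q.natDegree ≤ d) :
    Q.comp (X + C s) = ∑ ℓ ∈ range (d + 1), C ((fwdDiff (1:ℚ))^[ℓ] (fun t => Q.eval t) s) * newton ℓ := by
  -- the node set {0, 1, …, d}
  set S : Finset ℚ := (range (d + 1)).image fun m : ℕ => (m : ℚ) with hS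
  have hcard : S.card = d + 1 := by
    rw [hS, card_image_of_injective _ fun x y hxy => by simpa using hxy, card_range]
  apply Polynomial.eq_of_degrees_lt_of_eval_finset_eq S
  · rw [hcard]
    refine degree_le_natDegree.trans_lt ?_
    have : (Q.comp (X + C s)).natDegree ≤ d := by
      rw [natDegree_comp, natDegree_X_add_C, mul_one]; exact hd
    exact_mod_cast Nat.lt_succ_of_le this
  · rw [hcard]
    refine degree_le_natDegree.trans_lt ?_
    have : (∑ ℓ ∈ range (d + 1), C ((fwdDiff (1:ℚ))^[ℓ] (fun t => Q.eval t) s) * newton ℓ).natDegree ≤ d :=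
      natDegree_sum_le_of_forall_le _ _ fun ℓ hℓ =>
        (natDegree_C_mul_le _ _).trans (by rw [natDegree_newton]; exact Nat.le_of_lt_succ (mem_range.1 hℓ))
    exact_mod_cast Nat.lt_succ_of_le this
  · intro x hx
    rw [hS, mem_image] at hx
    obtain ⟨m, hm, rfl⟩ := hx
    rw [eval_comp, eval_add, eval_X, eval_C, eval_finsetSum]
    simp_rw [eval_mul, eval_C, eval_newton_nat]
    -- Gregory–Newton at y = s, n = m
    have hGN := shift_eq_sum_fwdDiff_iter (1 : ℚ) (fun t => Q.eval t) m s
    simp only [nsmul_eq_mul, mul_one] at hGN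
    rw [show (m : ℚ) + s = s + m by ring, hGN]
    -- extend the range from m+1 to d+1 (binomials vanish) and commute factors
    have hmd : m + 1 ≤ d + 1 := Nat.succ_le_succ (Nat.le_of_lt_succ (mem_range.1 hm))
    rw [← sum_range_add_sum_Ico _ hmd]
    have hz : ∑ k ∈ Ico (m + 1) (d + 1), ((fwdDiff (1:ℚ))^[k] (fun t => Q.eval t) s) * (m.choose k : ℚ) = 0 := by
      refine sum_eq_zero fun k hk => ?_
      rw [Nat.choose_eq_zero_of_lt (Nat.lt_of_succ_le (mem_Ico.1 hk).1)]
      simp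
    rw [hz, add_zero]
    exact sum_congr rfl fun k _ => by ring

/-- **`log(1+Δ) = d/dt` on `ℚ[X]`**: `Q′(s) = Σ_{ℓ<d} (−1)^ℓ Δ^{ℓ+1}[Q](s)/(ℓ+1)` for `deg Q ≤ d`. -/
theorem derivative_eval_eq_sum_fwdDiff (Q : ℚ[X]) (s : ℚ) {d : ℕ} (hd : Q.natDegree ≤ d) :
    (derivative Q).eval s = ∑ ℓ ∈ range d, (-1) ^ ℓ * ((fwdDiff (1:ℚ))^[ℓ + 1] (fun t => Q.eval t) s) / ((ℓ : ℚ) + 1) := by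
  have h := congrArg (fun P => (derivative P).eval 0) (newton_expansion Q s hd)
  rw [derivative_comp, derivative_X_add_C, one_mul, eval_comp, eval_add, eval_X, eval_C, zero_add] at h
  rw [h, derivative_sum, eval_finsetSum, sum_range_succ']
  simp_rw [derivative_C_mul, eval_mul, eval_C, derivative_newton_succ_eval_zero]
  rw [derivative_newton_zero, eval_zero, mul_zero, add_zero]
  exact sum_congr rfl fun ℓ _ => by ring

/-! ### The polynomial functional -/

/-- `lamPoly d s Q = Σ_{ℓ ≤ d} (−1)^ℓ Δ^ℓ[Q](s)/(ℓ+1)` — the formal value of `(1/2πi)∫_{Re t = s−1/2} (π/sin πt)² Q(t) dt`. -/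
def lamPoly (d : ℕ) (s : ℚ) (Q : ℚ[X]) : ℚ :=
  ∑ ℓ ∈ range (d + 1), (-1) ^ ℓ * ((fwdDiff (1:ℚ))^[ℓ] (fun t => Q.eval t) s) / ((ℓ : ℚ) + 1)

/-- Independence of the truncation: terms beyond `deg Q` vanish. -/
theorem lamPoly_eq_of_le (Q : ℚ[X]) (s : ℚ) {d d' : ℕ} (hd : Q.natDegree ≤ d) (hdd : d ≤ d') :
    lamPoly d' s Q = lamPoly d s Q := by
  unfold lamPoly
  rw [← sum_range_add_sum_Ico _ (Nat.succ_le_succ hdd)]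
  have hz : ∑ ℓ ∈ Ico (d + 1) (d' + 1), (-1) ^ ℓ * ((fwdDiff (1:ℚ))^[ℓ] (fun t => Q.eval t) s) / ((ℓ : ℚ) + 1) = 0 := by
    refine sum_eq_zero fun ℓ hℓ => ?_
    have hlt : Q.natDegree < ℓ := lt_of_lt_of_le (Nat.lt_succ_of_le hd) (mem_Ico.1 hℓ).1
    have := congrFun (Polynomial.fwdDiff_iter_eq_zero_of_degree_lt (P := Q) hlt) s
    simp only [Pi.zero_apply] at this
    rw [show (fun t => Q.eval t) = Q.eval from rfl, this]; simp
  rw [hz, add_zero]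

/-- Linearity in `Q`. -/
theorem lamPoly_add (d : ℕ) (s : ℚ) (Q₁ Q₂ : ℚ[X]) :
    lamPoly d s (Q₁ + Q₂) = lamPoly d s Q₁ + lamPoly d s Q₂ := by
  unfold lamPoly
  rw [← sum_add_distrib]
  refine sum_congr rfl fun ℓ _ => ?_
  have : (fun t => (Q₁ + Q₂).eval t) = (fun t => Q₁.eval t) + fun t => Q₂.eval t := by
    funext t; simp
  rw [this, fwdDiff_iter_add, Pi.add_apply]
  ring

/-- `lamPoly` is homogeneous: `lamPoly d s (C c * Q) = c * lamPoly d s Q`. (docstring added by the filing lane, lint only) -/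
theorem lamPoly_smul (d : ℕ) (s c : ℚ) (Q : ℚ[X]) :
    lamPoly d s (C c * Q) = c * lamPoly d s Q := by
  unfold lamPoly
  rw [mul_sum]
  refine sum_congr rfl fun ℓ _ => ?_
  have : (fun t => (C c * Q).eval t) = c • fun t => Q.eval t := by
    funext t; simp
  rw [this, fwdDiff_iter_const_smul, Pi.smul_apply, smul_eq_mul]
  ring

/-- **SHIFT law** (A): `Λ_s[Q(·+1)] = Λ_{s+1}[Q]`. -/
theorem lamPoly_shift (d : ℕ) (s : ℚ) (Q : ℚ[X]) :
    lamPoly d s (Q.comp (X + 1)) = lamPoly d (s + 1) Q := by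
  unfold lamPoly
  refine sum_congr rfl fun ℓ _ => ?_
  have : (fun t => (Q.comp (X + 1)).eval t) = fun r => (fun u => Q.eval u) (r + 1) := by
    funext t; simp [eval_comp]
  rw [this, fwdDiff_iter_comp_add (1 : ℚ) (fun u => Q.eval u) 1 ℓ s]

/-- **CROSSING law** (B): `Λ_{s+1}[Q] − Λ_s[Q] = Q′(s)` — the formal residue of `(π/sin πt)² Q(t)` at `t = s`. -/
theorem lamPoly_crossing (Q : ℚ[X]) (s : ℚ) {d : ℕ} (hd : Q.natDegree ≤ d) :
    lamPoly d (s + 1) Q - lamPoly d s Q = (derivative Q).eval s := by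
  rw [derivative_eval_eq_sum_fwdDiff Q s (Nat.le_succ_of_le hd)]
  unfold lamPoly
  rw [← sum_sub_distrib]
  refine sum_congr rfl fun ℓ _ => ?_
  rw [Function.iterate_succ_apply', fwdDiff]
  ring

end Summit.KontsevichZagierPeriods.Zeta5Search.FormalBarnes
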